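import Literature.AlgebraicGeometry.Motives.FiniteFlatDegreeProofs
import Literature.AlgebraicGeometry.Motives.CyclesDimensionProofs
import Literature.AlgebraicGeometry.Motives.Varieties
import HarnessLib

/-!
# Finite morphisms between smooth projective varieties of the same dimension preserve codimension

Book-keeping for finite projections `ψ : V → ℙᵈ` (and, generally, finite `k`-morphisms
`f : X → Y` between smooth projective varieties of the same dimension `n`): since a finite morphism
preserves the dimension of point closures (`Motives.height_base_eq_of_isFinite`) and
`dim + codim = n` on both sides (`Motives.height_add_coheight_eq_of_smoothOfRelativeDimension`),
it PRESERVES CODIMENSION (`coheight_base_eq_of_isFinite`). Hence the image of a closed irreducible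
`Z` of codimension exactly `l` is closed irreducible of codimension exactly `l`
(`image_codim_of_isFinite`) and every point of the preimage of a closed `T` of codimension `≥ l`
has codimension `≥ l` (`le_coheight_of_mem_preimage_of_isFinite`) — Hartshorne II Ex. 3.22 /
Fulton §11.4 (the cone `C_L(Z)` and `π⁻¹π(Z)` have the dimension of `Z`).

## References
* [Hartshorne1977] R. Hartshorne, Algebraic Geometry, II Ex. 3.20, II Ex. 3.22, II Ex. 4.1.
* [Fulton1998] W. Fulton, Intersection Theory, 2nd ed. 1998, §11.4.

#harness_tags algebraic_geometry.dimension, algebraic_geometry.finite_morphisms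
-/

noncomputable section

open CategoryTheory AlgebraicGeometry Set Order

universe u

namespace Literature.AlgebraicGeometry.Motives

section Finite

variable {k : Type u} [Field k] {n : ℕ} {X Y : SchemeOver k}

/-- **Finite morphisms between smooth projective varieties of the same dimension preserve
codimension**: `codim (f x) = codim x`. [cite: Hartshorne1977, II Ex. 3.20 (d) and II Ex. 3.22] -/
theorem coheight_base_eq_of_isFinite (hX : IsSmoothProjective n X) (hY : IsSmoothProjective n Y)
    (f : X ⟶ Y) [IsFinite f.left] (x : X.left) :
    coheight (f.left.base x) = coheight x := by
  haveI := hX.smoothOfRelativeDimension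
  haveI := hX.geometricallyIrreducible
  haveI : IrreducibleSpace ↥X.left := GeometricallyIrreducible.irreducibleSpace_of_subsingleton X.hom
  haveI := hY.smoothOfRelativeDimension
  haveI := hY.geometricallyIrreducible
  haveI : IrreducibleSpace ↥Y.left := GeometricallyIrreducible.irreducibleSpace_of_subsingleton Y.hom
  have hx : height x + coheight x = n := height_add_coheight_eq_of_smoothOfRelativeDimension X.hom n x
  have hy : height (f.left.base x) + coheight (f.left.base x) = n :=
    height_add_coheight_eq_of_smoothOfRelativeDimension Y.hom n (f.left.base x)
  rw [height_base_eq_of_isFinite f.left x] at hy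
  have hfin : height x ≠ ⊤ := (lt_of_le_of_lt (le_self_add.trans hx.le) (ENat.coe_lt_top n)).ne
  rw [← hx] at hy
  exact ENat.add_right_injective_of_ne_top hfin hy

/-- Every point of the preimage of a closed `T` with all points of codimension `≥ l` has
codimension `≥ l` (finite `f` between smooth projective varieties of the same dimension).
[cite: Hartshorne1977, II Ex. 3.22] -/
theorem le_coheight_of_mem_preimage_of_isFinite (hX : IsSmoothProjective n X)
    (hY : IsSmoothProjective n Y) (f : X ⟶ Y) [IsFinite f.left] {T : Set Y.left} {l : ℕ}
    (hcT : ∀ t ∈ T, (l : ℕ∞) ≤ coheight t) {x : X.left} (hx : x ∈ f.left.base ⁻¹' T) :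
    (l : ℕ∞) ≤ coheight x := by
  rw [← coheight_base_eq_of_isFinite hX hY f x]
  exact hcT _ hx

/-- **The image of a closed irreducible subset of codimension exactly `l` under a finite morphism
between smooth projective varieties of the same dimension is closed, irreducible, of codimension
exactly `l`.** [cite: Hartshorne1977, II Ex. 3.22 and II Ex. 4.1] [cite: Fulton1998, §11.4] -/
theorem image_codim_of_isFinite (hX : IsSmoothProjective n X) (hY : IsSmoothProjective n Y)
    (f : X ⟶ Y) [IsFinite f.left] {Z : Set X.left} {l : ℕ} (hZ : IsClosed Z) (hZi : IsIrreducible Z)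
    (hcZ : ∀ z ∈ Z, (l : ℕ∞) ≤ coheight z) (hZl : ∃ z ∈ Z, coheight z ≤ (l : ℕ∞)) :
    IsClosed (f.left.base '' Z) ∧ IsIrreducible (f.left.base '' Z) ∧
      (∀ t ∈ f.left.base '' Z, (l : ℕ∞) ≤ coheight t) ∧
      (∃ t ∈ f.left.base '' Z, coheight t ≤ (l : ℕ∞)) := by
  refine ⟨f.left.isClosedMap Z hZ, hZi.image _ f.left.continuous.continuousOn, ?_, ?_⟩
  · rintro _ ⟨z, hz, rfl⟩
    rw [coheight_base_eq_of_isFinite hX hY f z]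
    exact hcZ z hz
  · obtain ⟨z, hz, hzl⟩ := hZl
    exact ⟨f.left.base z, ⟨z, hz, rfl⟩, by rwa [coheight_base_eq_of_isFinite hX hY f z]⟩

end Finite

end Literature.AlgebraicGeometry.Motives
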